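import Summits.AtomisticToContinuum.HydrodynamicLimit.Theses.AntiMazurCoboundaries
import Literature.MathematicalPhysics.KineticTheory.HardSphereEulerProofs
import Literature.MathematicalPhysics.KineticTheory.HardBallErgodicity
import Literature.Analysis.FluidPDE.EmpiricalCollisionMeasure
import Summits.AtomisticToContinuum.HydrodynamicLimit.Theorems.CorrectorPressureDecay.Negative.MazurFloor

/-!
# Negative knowledge for `CorrectorPressureDecay` (stmt-AtomisticToContinuum-14135): fast-sector sandwich, core lemmas

Refuter `refuter-drefute-stmt-AtomisticToContinuum-14135-g2-0` (drefute gen 2 of the registered line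
`Cruxes/CorrectorPressureDecay/Lines/kinetic-entropy-collision-budget.lean`), 2026-08-16. Abstract half of the SANDWICH showing
that the line's open stub `stub_fastSectorDominance` is implied by discrete-window pressure decay (the frame half is
`Negative/FastSectorSandwich.lean`; prose: `Cruxes/CorrectorPressureDecay/DREFUTE-g2-FastSectorDominance.md`). Sorry-free.

* Part A (any probability space): for a bounded measurable potential `V`,
  `KL(μ.tilted V ‖ μ) = E_{tilt}[V] − log∫e^V` (`toReal_klDiv_tilted`) and
  `KL(μ.tilted V ‖ μ) ≤ log∫e^{2V} + 2·log∫e^{−V}` (`toReal_klDiv_tilted_le`: Jensen under the tilt with `Y = 2V` — the standing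
  disprover's `tilted_jensen`, imported from `Negative/MazurFloor.lean` — and `0 ≤ log∫e^{V} + log∫e^{−V}` by Jensen twice). The ENTROPY of an exponential tilt is
  bounded by two PRESSURES.
* Part B (one-body laws on `𝕋³ × ℝ³`, the line's `condRef/condKL/hellingerDev/fastDefect/fastDev` copied verbatim):
  `fastDev π ≤ condKL π` for every finite `π` (`fastDev_le_condKL`) — pointwise `(√r − 1)² ≤ klFun r` from the identity `klFun r − (√r − 1)² = 2√r·klFun(√r)`
  (`klFun_sub_sq_sqrt_sub_one`; the inequality itself is also the lead's `KineticEntropyCollisionBudget.sq_sqrt_sub_one_le_klFun`), Tonelli, Mathlib `klDiv_eq_lintegral_klFun_of_ac`. The WHOLE Hellinger deviation (slow AND fast sector) of a one-body law is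
  below its conditional velocity entropy.
Nothing here asserts a Theses decl.
-/

noncomputable section

open MeasureTheory ProbabilityTheory InformationTheory Set Filter Topology
open scoped ENNReal

namespace Summit.AtomisticToContinuum.HydrodynamicLimit.Theorems.CorrectorPressureDecayNegative.FastSectorSandwich

open Literature.MathematicalPhysics.KineticTheory (T3 V3 hsDiameter localGibbsLaw)
open Literature.Analysis.FluidPDE (HardSphereFlow Config)

/-! ## Part A — entropy of an exponential tilt is bounded by two pressures (abstract) -/

section Abstract

variable {X : Type*} [MeasurableSpace X]

/-- Jensen: `exp(∫ V dμ) ≤ ∫ e^V dμ` for a bounded measurable `V` and a probability measure `μ`. [folklore] -/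
theorem exp_integral_le_integral_exp {μ : Measure X} [IsProbabilityMeasure μ] {V : X → ℝ} (hVm : Measurable V)
    {C : ℝ} (hV : ∀ x, |V x| ≤ C) : Real.exp (∫ x, V x ∂μ) ≤ ∫ x, Real.exp (V x) ∂μ := by
  have h := tilted_jensen (μ := μ) (V := fun _ => (0 : ℝ)) (Y := V) measurable_const hVm (CV := 0)
    (fun _ => by simp) hV
  have htc : μ.tilted (fun _ => (0 : ℝ)) = μ := tilted_const μ 0
  simp only [Real.exp_zero, integral_const, probReal_univ, one_smul, sub_zero, htc, one_mul] at h
  exact h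

/-- `0 ≤ log ∫ e^V dμ + log ∫ e^{−V} dμ` (product of the two Jensen inequalities: `1 = e^{E V}e^{−E V} ≤ Z₊ Z₋`). [folklore] -/
theorem log_integral_exp_add_log_integral_exp_neg_nonneg {μ : Measure X} [IsProbabilityMeasure μ] {V : X → ℝ}
    (hVm : Measurable V) {C : ℝ} (hV : ∀ x, |V x| ≤ C) :
    0 ≤ Real.log (∫ x, Real.exp (V x) ∂μ) + Real.log (∫ x, Real.exp (-V x) ∂μ) := by
  have hVn : ∀ x, |(-V x)| ≤ C := fun x => by rw [abs_neg]; exact hV x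
  have h1 := exp_integral_le_integral_exp (μ := μ) hVm hV
  have hVnm : Measurable fun x => -V x := hVm.neg
  have h2 : Real.exp (∫ x, -V x ∂μ) ≤ ∫ x, Real.exp (-V x) ∂μ :=
    exp_integral_le_integral_exp (μ := μ) hVnm hVn
  have hZ1 : 0 < ∫ x, Real.exp (V x) ∂μ := integral_exp_pos (integrable_exp_of_abs_le hVm hV)
  have hZ2 : 0 < ∫ x, Real.exp (-V x) ∂μ := integral_exp_pos (integrable_exp_of_abs_le hVnm hVn)
  rw [← Real.log_mul hZ1.ne' hZ2.ne']
  refine Real.log_nonneg ?_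
  have hneg : ∫ x, -V x ∂μ = -∫ x, V x ∂μ := integral_neg V
  rw [hneg] at h2
  calc (1 : ℝ) = Real.exp (∫ x, V x ∂μ) * Real.exp (-∫ x, V x ∂μ) := by
        rw [← Real.exp_add, add_neg_cancel, Real.exp_zero]
    _ ≤ (∫ x, Real.exp (V x) ∂μ) * ∫ x, Real.exp (-V x) ∂μ :=
        mul_le_mul h1 h2 (Real.exp_pos _).le hZ1.le

/-- The log-likelihood ratio of a bounded tilt is a.e. the bounded function `V − log Z`. [folklore] -/
theorem llr_tilted_ae_eq {μ : Measure X} [IsProbabilityMeasure μ] {V : X → ℝ} (hVm : Measurable V) {C : ℝ}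
    (hV : ∀ x, |V x| ≤ C) :
    llr (μ.tilted V) μ =ᵐ[μ.tilted V] fun x => V x - Real.log (∫ x, Real.exp (V x) ∂μ) := by
  have hexpV : Integrable (fun x => Real.exp (V x)) μ := integrable_exp_of_abs_le hVm hV
  have h := log_rnDeriv_tilted_left_self hexpV
  exact (tilted_absolutelyContinuous μ V).ae_le h

/-- KL of a bounded tilt is finite. [folklore] -/
theorem klDiv_tilted_ne_top {μ : Measure X} [IsProbabilityMeasure μ] {V : X → ℝ} (hVm : Measurable V) {C : ℝ}
    (hV : ∀ x, |V x| ≤ C) : klDiv (μ.tilted V) μ ≠ ∞ := by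
  have hexpV : Integrable (fun x => Real.exp (V x)) μ := integrable_exp_of_abs_le hVm hV
  haveI : IsProbabilityMeasure (μ.tilted V) := isProbabilityMeasure_tilted hexpV
  refine klDiv_ne_top (tilted_absolutelyContinuous μ V) ?_
  refine (integrable_congr (llr_tilted_ae_eq hVm hV)).2 ?_
  exact (integrable_of_abs_le hVm hV).sub (integrable_const _)

/-- **Gibbs variational identity at the tilt**: `KL(μ.tilted V ‖ μ) = ∫ V d(μ.tilted V) − log ∫ e^V dμ`. [folklore] -/
theorem toReal_klDiv_tilted {μ : Measure X} [IsProbabilityMeasure μ] {V : X → ℝ} (hVm : Measurable V) {C : ℝ}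
    (hV : ∀ x, |V x| ≤ C) :
    (klDiv (μ.tilted V) μ).toReal = (∫ x, V x ∂(μ.tilted V)) - Real.log (∫ x, Real.exp (V x) ∂μ) := by
  have hexpV : Integrable (fun x => Real.exp (V x)) μ := integrable_exp_of_abs_le hVm hV
  haveI : IsProbabilityMeasure (μ.tilted V) := isProbabilityMeasure_tilted hexpV
  rw [toReal_klDiv_of_measure_eq (tilted_absolutelyContinuous μ V) (by simp),
    integral_congr_ae (llr_tilted_ae_eq hVm hV), integral_sub (integrable_of_abs_le hVm hV) (integrable_const _),
    integral_const, probReal_univ, one_smul]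

/-- **MAIN ABSTRACT LEMMA (entropy ≤ two pressures).** For a probability measure `μ` and a bounded measurable
`V`: `KL(μ.tilted V ‖ μ) ≤ log ∫ e^{2V} dμ + 2 · log ∫ e^{−V} dμ`. Proof: `KL = E_{tilt}V − log Z₁`
(`toReal_klDiv_tilted`), `log Z₁ + E_{tilt}V ≤ log Z₂` (`tilted_jensen` with `Y = 2V`), and
`−2 log Z₁ ≤ 2 log Z₋₁` (`log_integral_exp_add_log_integral_exp_neg_nonneg`). [folklore] -/
theorem toReal_klDiv_tilted_le {μ : Measure X} [IsProbabilityMeasure μ] {V : X → ℝ} (hVm : Measurable V)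
    {C : ℝ} (hV : ∀ x, |V x| ≤ C) :
    (klDiv (μ.tilted V) μ).toReal ≤
      Real.log (∫ x, Real.exp (2 * V x) ∂μ) + 2 * Real.log (∫ x, Real.exp (-V x) ∂μ) := by
  have hexpV : Integrable (fun x => Real.exp (V x)) μ := integrable_exp_of_abs_le hVm hV
  have hZ1 : 0 < ∫ x, Real.exp (V x) ∂μ := integral_exp_pos hexpV
  have h2V : ∀ x, |2 * V x| ≤ 2 * C := fun x => by
    rw [abs_mul, abs_of_pos (by norm_num : (0 : ℝ) < 2)]
    exact mul_le_mul_of_nonneg_left (hV x) (by norm_num)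
  have hJ := tilted_jensen (μ := μ) hVm (hVm.const_mul 2) hV h2V
  have hsub : (fun x => 2 * V x - V x) = V := by funext x; ring
  rw [hsub] at hJ
  -- take logarithms: `log Z₁ + E_{tilt} V ≤ log Z₂`
  have hpos : 0 < (∫ x, Real.exp (V x) ∂μ) * Real.exp (∫ x, V x ∂(μ.tilted V)) := mul_pos hZ1 (Real.exp_pos _)
  have hlog := Real.log_le_log hpos hJ
  rw [Real.log_mul hZ1.ne' (Real.exp_pos _).ne', Real.log_exp] at hlog
  have h0 := log_integral_exp_add_log_integral_exp_neg_nonneg (μ := μ) hVm hV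
  rw [toReal_klDiv_tilted hVm hV]
  linarith

end Abstract

/-! ## Part B — the whole Hellinger deviation of a one-body law is below its conditional entropy -/

section OneBody

/-- (skeleton, verbatim) The locally-Maxwellian reference of a one-body law. [folklore] -/
def condRef (π : Measure (T3 × V3)) : Measure (T3 × V3) :=
  π.fst.prod (stdGaussian V3)

/-- (skeleton, verbatim) Conditional velocity entropy `KL(π ‖ πˣ ⊗ γ)`. [folklore] -/
def condKL (π : Measure (T3 × V3)) : ℝ≥0∞ :=
  klDiv π (condRef π)

/-- (skeleton, verbatim) The Hellinger variable `u = √r − 1`, `r = dπ/d(πˣ ⊗ γ)`. [folklore] -/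
def hellingerDev (π : Measure (T3 × V3)) (p : T3 × V3) : ℝ :=
  Real.sqrt ((π.rnDeriv (condRef π) p).toReal) - 1

/-- (skeleton, verbatim) Fast defect of a velocity function. [folklore] -/
def fastDefect (w : V3 → ℝ) : ℝ≥0∞ :=
  ⨅ q : ℝ × V3 × ℝ,
    ∫⁻ v, ENNReal.ofReal ((w v - (q.1 + inner ℝ q.2.1 v + q.2.2 * ‖v‖ ^ 2)) ^ 2) ∂(stdGaussian V3)

/-- (skeleton, verbatim) Fast deviation of a one-body law. [folklore] -/
def fastDev (π : Measure (T3 × V3)) : ℝ≥0∞ :=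
  ∫⁻ x, fastDefect (fun v => hellingerDev π (x, v)) ∂π.fst

/-- The pointwise identity behind "Hellinger ≤ KL": `klFun r − (√r − 1)² = 2√r · klFun(√r)` (`r ≥ 0`). [folklore] -/
theorem klFun_sub_sq_sqrt_sub_one {r : ℝ} (hr : 0 ≤ r) :
    klFun r - (Real.sqrt r - 1) ^ 2 = 2 * Real.sqrt r * klFun (Real.sqrt r) := by
  have hs0 : 0 ≤ Real.sqrt r := Real.sqrt_nonneg r
  have hr' : r = Real.sqrt r ^ 2 := (Real.sq_sqrt hr).symm
  set s := Real.sqrt r with hs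
  rw [hr', klFun_apply, klFun_apply, Real.log_pow, Nat.cast_ofNat]
  ring

/-- The fast defect is at most the full `L²(γ)` norm (take the quadratic weight `0`). [folklore] -/
theorem fastDefect_le_lintegral_sq (w : V3 → ℝ) :
    fastDefect w ≤ ∫⁻ v, ENNReal.ofReal ((w v) ^ 2) ∂(stdGaussian V3) := by
  refine (iInf_le _ ((0 : ℝ), (0 : V3), (0 : ℝ))).trans (le_of_eq ?_)
  refine lintegral_congr fun v => ?_
  simp

/-- **Part B.** For every finite one-body law `π` on `𝕋³ × ℝ³`: `fastDev π ≤ condKL π` — the WHOLE Hellinger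
deviation `∫‖√r − 1‖²_{L²(γ)} dπˣ` (not only its fast-sector part) is below the conditional velocity entropy. [folklore] -/
theorem fastDev_le_condKL (π : Measure (T3 × V3)) [IsFiniteMeasure π] : fastDev π ≤ condKL π := by
  unfold fastDev condKL
  by_cases hac : π ≪ condRef π
  swap
  · rw [klDiv_of_not_ac hac]; exact le_top
  haveI : IsFiniteMeasure (condRef π) := by unfold condRef; infer_instance
  rw [klDiv_eq_lintegral_klFun_of_ac hac]
  have hmeas : Measurable fun p : T3 × V3 => ENNReal.ofReal (klFun ((π.rnDeriv (condRef π) p).toReal)) :=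
    (measurable_klFun.comp (Measure.measurable_rnDeriv _ _).ennreal_toReal).ennreal_ofReal
  have hprod : ∫⁻ p, ENNReal.ofReal (klFun ((π.rnDeriv (condRef π) p).toReal)) ∂(condRef π) =
      ∫⁻ x, ∫⁻ v, ENNReal.ofReal (klFun ((π.rnDeriv (condRef π) (x, v)).toReal)) ∂(stdGaussian V3) ∂π.fst := by
    show ∫⁻ p, ENNReal.ofReal (klFun ((π.rnDeriv (condRef π) p).toReal)) ∂(π.fst.prod (stdGaussian V3)) = _
    exact lintegral_prod _ hmeas.aemeasurable
  rw [hprod]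
  refine lintegral_mono fun x => ?_
  refine (fastDefect_le_lintegral_sq _).trans ?_
  refine lintegral_mono fun v => ?_
  unfold hellingerDev
  refine ENNReal.ofReal_le_ofReal ?_
  -- `(√r − 1)² ≤ klFun r` from the identity `klFun r − (√r − 1)² = 2√r·klFun(√r) ≥ 0`
  set r : ℝ := (π.rnDeriv (condRef π) (x, v)).toReal with hr
  have hr0 : 0 ≤ r := ENNReal.toReal_nonneg
  have hid := klFun_sub_sq_sqrt_sub_one hr0
  have h2 : 0 ≤ 2 * Real.sqrt r * klFun (Real.sqrt r) :=
    mul_nonneg (mul_nonneg (by norm_num) (Real.sqrt_nonneg r)) (klFun_nonneg (Real.sqrt_nonneg r))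
  linarith

end OneBody



end Summit.AtomisticToContinuum.HydrodynamicLimit.Theorems.CorrectorPressureDecayNegative.FastSectorSandwich

end
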